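import Literature.NumberTheory.GaloisCohomology.PoitouTateRestrictedShaNaturalAtOfP2mono
import Literature.NumberTheory.GaloisCohomology.RestrictedRamificationExtOneLayerNat
import HarnessLib

/-!
# `poitouTate_shaRestricted_tateDual_natural_at K ↑S'` (`K` totally complex) from TWO displayed inputs:
# [P2-mono] and the canonical `S`-readouts — the layer bridge `nat := natLayerS` PLUGGED IN

Topic `NumberTheory/GaloisCohomology`; namespace `Literature.NumberTheory.GaloisCohomology.ShaExtRoadKit`.  Theorems only
(no definition, no named fact, no instance, no notation, no `sorry`).  Lane «PT-Ш-S-TC» of cell `bsd-eis` (crux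
`GoodLatticeBDPValue`, `stmt-BirchSwinnertonDyer-19032`), KIT GLUE (seat bsd-line-x1-p1-w2 gen 12), sequel of
`PoitouTateRestrictedShaNaturalAtOfP2mono`: in `natural_at_of_P2mono'` the degree-`1` bridge slot
`nat n M ρ : H¹(G_S, (M^D(n))^{N_S}) →+ Ext¹_{C_{G_S}}(ℤ, ⟨(M^D(n))^{N_S}⟩)` is filled with the LAYER-currency bridge
`RestrictedExtLayer.natLayerS (ρ.tateDual n) ↑S'` (bsd-eis -w5 g11, re-filed by -w6 g12): `hnat := natLayerS_bijective`,
`hnatG := natLayerS_symm_naturality` (instantiated at the adjoint map `G : (M'^D(n'))^{·} → (M^D(n))^{·}`).  What stays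
displayed: [P2-mono] (E4e shape, every open normal `U ≤ G_S`) and the `S`-readouts `R` on admissible triples with (R3)/(R4)
at `linv := LocalInvariants.canonical`, `Sig := Finset.univ.disjSum S'`, `nat := natLayerS (ρ.tateDual n) ↑S'` — the exact
output of the lane's F2d assembly (`readoutSExtB`, `exists_forall_mem_readoutSExtB_eq`, `read_idelePart_eq_sum`).

HONEST FRAMING: plumbing; neither displayed input is proved here; no case of Poitou–Tate duality and nothing about BSD is
proved here.  AI formalisation, established only by the kernel check.

## References
* J. S. Milne, *Arithmetic Duality Theorems*, 2nd ed. (2006), I Thm. 4.10 (a) (p. 57), its proof (p. 58), §4 p. 65. [MilneADT2006]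
* D. Harari, *Galois Cohomology and Class Field Theory*, Universitext (2020), §4.3 Remark 4.24, §17.4 (17.1), Thm. 17.13 (b),
  §17.5. [Harari2020]
* J.-P. Serre, *Galois Cohomology* (1997), I §2.2 Proposition 8. [SerreGaloisCohomology1997]
-/

noncomputable section

open CategoryTheory CategoryTheory.Abelian NumberField IsDedekindDomain Function Field
open scoped NumberField ContRepresentation

namespace Literature.NumberTheory.GaloisCohomology

namespace ShaExtRoadKit

open Literature.Algebra.Homology Literature.Algebra.Homology.DiscreteRep Literature.Algebra.Homology.ExtDuality
open Literature.NumberTheory.GaloisRepresentations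
open Literature.NumberTheory.GaloisRepresentations.DiscreteGaloisModule
open Literature.AnabelianGeometry.AbsoluteAnabelian.Prop121vii (zmodToQmodZ)

variable (K : Type) [Field K] [NumberField K] (S : Finset (HeightOneSpectrum (𝓞 K)))

set_option maxRecDepth 16384 in
-- (as for `natural_at_of_kit`: the composed objects exceed the default recursion depth)
/-- **`poitouTate_shaRestricted_tateDual_natural_at K ↑S'` for `K` totally complex from [P2-mono] and the canonical
`S`-readouts on admissible triples, with `nat := natLayerS (ρ.tateDual n) ↑S'`.**
[cite: MilneADT2006, I Thm. 4.10 (a) (p. 57), its proof (p. 58) and §4 p. 65][cite: Harari2020, §4.3 Remark 4.24, §17.5]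
[cite: SerreGaloisCohomology1997, I §2.2 Proposition 8] -/
theorem natural_at_of_P2mono_natLayerS [IsTotallyComplex K]
    (hP2 : ∀ (U : Subgroup (GaloisGroupUnramifiedOutside K (↑S : Set (HeightOneSpectrum (𝓞 K))))) [U.Normal]
      (_ : IsOpen (U : Set (GaloisGroupUnramifiedOutside K (↑S : Set (HeightOneSpectrum (𝓞 K)))))) [U.FiniteIndex],
      ∀ y : Ext (triv (k := ℤ) (Γ := ↥U) ℤ) ((resD ℤ U).obj (IdeleClassBar.truncIdeleBarD K S)) 2,
        (∀ (w : IdeleReadout.OverS K S) (t : DoubleCosets (IdeleReadout.decompMapPlaceS K S w.1) U),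
          (y.mapExactFunctor (resDHom ℤ (conjHom (IdeleReadout.decompMapPlaceS K S w.1) U
              (dcRep (IdeleReadout.decompMapPlaceS K S w.1) U t))
            (continuous_conjHom (IdeleReadout.decompMapPlaceS K S w.1) (IdeleReadout.continuous_decompMapPlaceS K S w.1) U
              (dcRep (IdeleReadout.decompMapPlaceS K S w.1) U t)))).comp
            (Ext.mk₀ (conjCoeff (IdeleReadout.decompMapPlaceS K S w.1) (IdeleReadout.continuous_decompMapPlaceS K S w.1) U
              (IdeleClassBar.truncIdeleBarD K S) (IdeleReadout.unitsD (Place.Completion w.1)) (IdeleReadout.locQ K S w)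
              (dcRep (IdeleReadout.decompMapPlaceS K S w.1) U t) (k := ℤ))) (add_zero 2) = 0) → y = 0)
    (R : ∀ (n : ℕ) [NeZero n] (M : Type) [AddCommGroup M] [TopologicalSpace M] [DiscreteTopology M] [Finite M]
      (ρ : DiscreteGaloisModule K M), (∀ m : M, n • m = 0) →
      GaloisRep.IsUnramifiedOutside (↑S : Set (HeightOneSpectrum (𝓞 K))) ρ →
      (∀ v : HeightOneSpectrum (𝓞 K), ((Nat.card M : ℕ) : 𝓞 K) ∈ v.asIdeal → v ∈ (↑S : Set (HeightOneSpectrum (𝓞 K)))) →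
      ∀ v : Place K, Ext (ofContinuousRep ((ρ.tateDual n).quotientInvariants
        (ramificationSubgroup K (↑S : Set (HeightOneSpectrum (𝓞 K)))))) (IdeleClassBar.truncIdeleBarD K S) 1 →+
          galoisCohomology (ρ.toLocal v) 1)
    (hR3 : ∀ (n : ℕ) [NeZero n] (M : Type) [AddCommGroup M] [TopologicalSpace M] [DiscreteTopology M]
      [Finite M] (ρ : DiscreteGaloisModule K M) (hn : ∀ m : M, n • m = 0)
      (hur : GaloisRep.IsUnramifiedOutside (↑S : Set (HeightOneSpectrum (𝓞 K))) ρ)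
      (hS : ∀ v : HeightOneSpectrum (𝓞 K), ((Nat.card M : ℕ) : 𝓞 K) ∈ v.asIdeal → v ∈ (↑S : Set (HeightOneSpectrum (𝓞 K)))),
      ∀ t : Π v : Place K, galoisCohomology (ρ.toLocal v) 1,
        ∃ e : Ext (ofContinuousRep ((ρ.tateDual n).quotientInvariants
        (ramificationSubgroup K (↑S : Set (HeightOneSpectrum (𝓞 K)))))) (IdeleClassBar.truncIdeleBarD K S) 1,
          ∀ v ∈ (Finset.univ : Finset (InfinitePlace K)).disjSum S, R n M ρ hn hur hS v e = t v)
    (hR4 : ∀ (n : ℕ) [NeZero n] (M : Type) [AddCommGroup M] [TopologicalSpace M] [DiscreteTopology M]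
      [Finite M] (ρ : DiscreteGaloisModule K M) (hn : ∀ m : M, n • m = 0)
      (hur : GaloisRep.IsUnramifiedOutside (↑S : Set (HeightOneSpectrum (𝓞 K))) ρ)
      (hS : ∀ v : HeightOneSpectrum (𝓞 K), ((Nat.card M : ℕ) : 𝓞 K) ∈ v.asIdeal → v ∈ (↑S : Set (HeightOneSpectrum (𝓞 K))))
      (e : Ext (ofContinuousRep ((ρ.tateDual n).quotientInvariants
        (ramificationSubgroup K (↑S : Set (HeightOneSpectrum (𝓞 K)))))) (IdeleClassBar.truncIdeleBarD K S) 1)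
      (y : restrictedCohomology (ρ.tateDual n) (↑S : Set (HeightOneSpectrum (𝓞 K))) 1),
        ShaExtRoad.read ρ (↑S : Set (HeightOneSpectrum (𝓞 K))) (T := IdeleClassBar.truncSeqS K S) (ofContinuousRep ((ρ.tateDual n).quotientInvariants
        (ramificationSubgroup K (↑S : Set (HeightOneSpectrum (𝓞 K)))))) (triv ℤ) (IdeleClassBar.invS S)
            (RestrictedExtLayer.natLayerS (ρ.tateDual n) (↑S : Set (HeightOneSpectrum (𝓞 K))))
            (ShaExtRoad.idelePart (T := IdeleClassBar.truncSeqS K S) (ofContinuousRep ((ρ.tateDual n).quotientInvariants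
        (ramificationSubgroup K (↑S : Set (HeightOneSpectrum (𝓞 K)))))) e) y =
          zmodToQmodZ n (∑ v ∈ (Finset.univ : Finset (InfinitePlace K)).disjSum S,
            localTatePairingZMod ρ n v (LocalInvariants.canonical K n v) (R n M ρ hn hur hS v e)
            (restrictedLocalization (ρ.tateDual n) (↑S : Set (HeightOneSpectrum (𝓞 K))) v 1 y))) :
    poitouTate_shaRestricted_tateDual_natural_at K (↑S : Set (HeightOneSpectrum (𝓞 K))) :=
  natural_at_of_P2mono' K S hP2
    (fun n _ _ _ _ _ ρ => RestrictedExtLayer.natLayerS (ρ.tateDual n) (↑S : Set (HeightOneSpectrum (𝓞 K))))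
    (fun n _ _ _ _ _ ρ => RestrictedExtLayer.natLayerS_bijective (ρ.tateDual n) (↑S : Set (HeightOneSpectrum (𝓞 K))))
    (fun n n' _ _ _ _ _ _ _ _ _ _ ρ ρ' G c =>
      RestrictedExtLayer.natLayerS_symm_naturality (ρ'.tateDual n') (ρ.tateDual n) (↑S : Set (HeightOneSpectrum (𝓞 K))) G c)
    R hR3 hR4

end ShaExtRoadKit

end Literature.NumberTheory.GaloisCohomology

end
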